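import Summits.QuantumAdvantage.QuantumAdvantage.Theorems.CharDialWalkHardFSubLog
import HarnessLib

/-!
# SupportBound — a non-zero function of degree ≤ d on the n-cube has ≥ 2^(n−d) non-zeros

(decomp-qadv-lens-6 g8; the support lemma used twice in PLAN-g9.md §11: in 11.2 (γ = 0 is impossible) and 11.4
(boundedly many twist coordinates).)  Proof without induction on the dimension: take a Möbius coefficient
`μ_S(g) ≠ 0` with `S` maximal; for every freezing `v` of the coordinates off `S` the restriction over `S` still has
`μ_S = μ_S(g) ≠ 0` (`moeb_restr_eq` — only monomials `A ⊇ S` contribute), so each of the `2^{n−|S|}` disjoint subcubes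
contains a non-zero of `g`, and `|S| ≤ d` by `moeb_eq_zero_of_mem_lowDeg`.
-/

namespace Summit.QuantumAdvantage.AdviceFreeQNC0

namespace SubLog

open Finset
open Literature.Computability.MetaComplexity Literature.Computability.MetaComplexity.Smolensky

variable {n : ℕ}

/-- `merge S u v` = `u` on `S`, `v` off `S`. -/
def merge (S : Finset (Fin n)) (u v : Fin n → Bool) : Fin n → Bool := fun i => if i ∈ S then u i else v i

/-- The restriction of `g` to the subcube over `S` with the outside frozen to `v` (as a function of all inputs,
constant in the coordinates off `S`). -/
def restr {R : Type*} (S : Finset (Fin n)) (v : Fin n → Bool) (g : (Fin n → Bool) → R) : (Fin n → Bool) → R :=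
  fun u => g (merge S u v)

section Field

variable {F : Type*} [Field F]

/-- CharDial sub-characteristic helper `restr_mono` (lens-6 g8 LAND package; see the module docstring). -/
theorem restr_mono (S : Finset (Fin n)) (v : Fin n → Bool) (A : Finset (Fin n)) :
    restr S v (mono F A) = (if ∀ i ∈ A \ S, v i = true then (1 : F) else 0) • mono F (A ∩ S) := by
  classical
  funext u
  simp only [restr, Pi.smul_apply, smul_eq_mul, mono_apply]
  by_cases hv : ∀ i ∈ A \ S, v i = true
  · rw [if_pos hv, one_mul]
    apply if_congr _ rfl rfl
    constructor
    · intro h i hi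
      have h' := h i (Finset.mem_inter.1 hi).1
      simpa [merge, (Finset.mem_inter.1 hi).2] using h'
    · intro h i hiA
      by_cases hiS : i ∈ S
      · have h' := h i (Finset.mem_inter.2 ⟨hiA, hiS⟩)
        simpa [merge, hiS] using h'
      · simpa [merge, hiS] using hv i (Finset.mem_sdiff.2 ⟨hiA, hiS⟩)
  · rw [if_neg hv, zero_mul, if_neg]
    intro h
    apply hv
    intro i hi
    have h' := h i (Finset.mem_sdiff.1 hi).1
    simpa [merge, (Finset.mem_sdiff.1 hi).2] using h'

/-- Restriction over `S` (outside frozen) does not raise the degree. -/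
theorem restr_mem_lowDeg (S : Finset (Fin n)) (v : Fin n → Bool) {d : ℕ} {g : CubeFn F n}
    (hg : g ∈ lowDeg F n d) : restr S v g ∈ lowDeg F n d := by
  classical
  let L : CubeFn F n →ₗ[F] CubeFn F n :=
    { toFun := fun h => restr S v h, map_add' := fun _ _ => rfl, map_smul' := fun _ _ => rfl }
  have hle : (lowDeg F n d).map L ≤ lowDeg F n d := by
    rw [lowDeg_eq_span (D := d), Submodule.map_span_le]
    rintro _ ⟨⟨A, hA⟩, rfl⟩
    show restr S v (mono F A) ∈ _
    rw [restr_mono]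
    exact Submodule.smul_mem _ _ (mono_mem_lowDeg (le_trans (Finset.card_le_card Finset.inter_subset_left) hA))
  exact hle (Submodule.mem_map_of_mem hg)

/-- `μ_S` of the restriction over `S` of a monomial `x_A`: non-zero only for `A ⊇ S`. -/
theorem moeb_restr_mono (S : Finset (Fin n)) (v : Fin n → Bool) (A : Finset (Fin n)) :
    moeb (restr S v (mono F A)) S = if S ⊆ A ∧ (∀ i ∈ A \ S, v i = true) then 1 else 0 := by
  classical
  rw [restr_mono, moeb_smul, moeb_mono]
  by_cases hv : ∀ i ∈ A \ S, v i = true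
  · rw [if_pos hv, one_mul]
    by_cases hSA : S ⊆ A
    · rw [if_pos (Finset.inter_eq_right.2 hSA), if_pos ⟨hSA, hv⟩]
    · rw [if_neg (fun h => hSA (by rw [← h]; exact Finset.inter_subset_left)), if_neg (fun h => hSA h.1)]
  · rw [if_neg hv, zero_mul, if_neg (fun h => hv h.2)]

/-- If `μ_T(g) = 0` for every strict superset `T ⊋ S`, every restriction over `S` keeps `μ_S = μ_S(g)`. -/
theorem moeb_restr_eq (g : CubeFn F n) (S : Finset (Fin n)) (hmax : ∀ T, S ⊂ T → moeb g T = 0)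
    (v : Fin n → Bool) : moeb (restr S v g) S = moeb g S := by
  classical
  let L : CubeFn F n →ₗ[F] F :=
    { toFun := fun h => moeb (restr S v h) S
      map_add' := fun h h' => by
        show moeb (restr S v (h + h')) S = moeb (restr S v h) S + moeb (restr S v h') S
        have hh : restr S v (h + h') = restr S v h + restr S v h' := rfl
        rw [hh, moeb_add]
      map_smul' := fun a h => by
        show moeb (restr S v (a • h)) S = a • moeb (restr S v h) S
        have hh : restr S v (a • h) = a • restr S v h := rfl
        rw [hh, moeb_smul, smul_eq_mul] }
  have hL : ∀ h, L h = moeb (restr S v h) S := fun h => rfl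
  have step : L g = ∑ A : Finset (Fin n), moeb g A * (if S ⊆ A ∧ (∀ i ∈ A \ S, v i = true) then 1 else 0) := by
    conv_lhs => rw [eq_sum_moeb_smul_mono g]
    rw [map_sum]
    refine Finset.sum_congr rfl fun A _ => ?_
    rw [map_smul, smul_eq_mul, hL, moeb_restr_mono]
  rw [← hL, step, Finset.sum_eq_single S]
  · simp
  · intro A _ hAS
    by_cases hSA : S ⊆ A
    · rw [hmax A (Finset.ssubset_iff_subset_ne.2 ⟨hSA, Ne.symm hAS⟩), zero_mul]
    · rw [if_neg (fun h => hSA h.1), mul_zero]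
  · intro h
    exact absurd (Finset.mem_univ S) h

/-- `μ_T` of the restriction over `S` of a monomial `x_A`, for any `T`. -/
theorem moeb_restr_mono' (S T : Finset (Fin n)) (v : Fin n → Bool) (A : Finset (Fin n)) :
    moeb (restr S v (mono F A)) T = if A ∩ S = T ∧ (∀ i ∈ A \ S, v i = true) then 1 else 0 := by
  classical
  rw [restr_mono, moeb_smul, moeb_mono]
  by_cases hv : ∀ i ∈ A \ S, v i = true
  · rw [if_pos hv, one_mul]
    by_cases hAT : A ∩ S = T
    · rw [if_pos hAT, if_pos ⟨hAT, hv⟩]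
    · rw [if_neg hAT, if_neg (fun h => hAT h.1)]
  · rw [if_neg hv, zero_mul, if_neg (fun h => hv h.2)]

/-- **Top-layer coefficients are restriction-invariant**: for `g` of degree `≤ d`, `|T| = d` and `T ⊆ S`, every
restriction over `S` has `μ_T = μ_T(g)` (PLAN-g9.md §11.1–11.3: slices of `f` keep the top layer of `f`). -/
theorem moeb_restr_eq_of_card_eq {d : ℕ} {g : CubeFn F n} (hg : g ∈ lowDeg F n d) {S T : Finset (Fin n)}
    (hTS : T ⊆ S) (hTd : T.card = d) (v : Fin n → Bool) : moeb (restr S v g) T = moeb g T := by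
  classical
  let L : CubeFn F n →ₗ[F] F :=
    { toFun := fun h => moeb (restr S v h) T
      map_add' := fun h h' => by
        show moeb (restr S v (h + h')) T = moeb (restr S v h) T + moeb (restr S v h') T
        have hh : restr S v (h + h') = restr S v h + restr S v h' := rfl
        rw [hh, moeb_add]
      map_smul' := fun a h => by
        show moeb (restr S v (a • h)) T = a • moeb (restr S v h) T
        have hh : restr S v (a • h) = a • restr S v h := rfl
        rw [hh, moeb_smul, smul_eq_mul] }
  have hL : ∀ h, L h = moeb (restr S v h) T := fun h => rfl
  have step : L g = ∑ A : Finset (Fin n), moeb g A * (if A ∩ S = T ∧ (∀ i ∈ A \ S, v i = true) then 1 else 0) := by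
    conv_lhs => rw [eq_sum_moeb_smul_mono g]
    rw [map_sum]
    refine Finset.sum_congr rfl fun A _ => ?_
    rw [map_smul, smul_eq_mul, hL, moeb_restr_mono']
  rw [← hL, step, Finset.sum_eq_single T]
  · have hcond : T ∩ S = T ∧ ∀ i ∈ T \ S, v i = true :=
      ⟨Finset.inter_eq_left.2 hTS, fun i hi => absurd (hTS (Finset.mem_sdiff.1 hi).1) (Finset.mem_sdiff.1 hi).2⟩
    rw [if_pos hcond, mul_one]
  · intro A _ hAT
    by_cases hc : moeb g A = 0
    · rw [hc, zero_mul]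
    · rw [if_neg, mul_zero]
      rintro ⟨hATS, -⟩
      have hAd : A.card ≤ d := not_lt.1 fun h => hc (moeb_eq_zero_of_mem_lowDeg hg h)
      have hTA : T ⊆ A := by rw [← hATS]; exact Finset.inter_subset_left
      exact hAT (Finset.eq_of_subset_of_card_le hTA (by omega)).symm
  · intro h
    exact absurd (Finset.mem_univ T) h

/-- A non-zero function has a maximal non-zero Möbius coefficient. -/
theorem exists_maximal_moeb_ne_zero (g : CubeFn F n) (hne : g ≠ 0) :
    ∃ S : Finset (Fin n), moeb g S ≠ 0 ∧ ∀ T, S ⊂ T → moeb g T = 0 := by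
  classical
  set M : Finset (Finset (Fin n)) := Finset.univ.filter fun S => moeb g S ≠ 0 with hM
  have hMne : M.Nonempty := by
    by_contra h
    rw [Finset.not_nonempty_iff_eq_empty] at h
    apply hne
    rw [eq_sum_moeb_smul_mono g]
    refine Finset.sum_eq_zero fun S _ => ?_
    have h0 : moeb g S = 0 := by
      by_contra hS
      have hSM : S ∈ M := Finset.mem_filter.2 ⟨Finset.mem_univ _, hS⟩
      rw [h] at hSM
      exact absurd hSM (Finset.notMem_empty _)
    rw [h0, zero_smul]
  obtain ⟨S, hSM, hSmax⟩ := Finset.exists_max_image M Finset.card hMne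
  refine ⟨S, (Finset.mem_filter.1 hSM).2, fun T hT => ?_⟩
  by_contra hT0
  have hTM : T ∈ M := Finset.mem_filter.2 ⟨Finset.mem_univ _, hT0⟩
  exact absurd (hSmax T hTM) (not_le.2 (Finset.card_lt_card hT))

/-- **Support bound**: a non-zero `g` of degree `≤ d` on the `n`-cube has at least `2^{n−d}` non-zeros. -/
theorem card_support_ge_of_mem_lowDeg [DecidableEq F] {d : ℕ} {g : CubeFn F n} (hg : g ∈ lowDeg F n d)
    (hne : g ≠ 0) :
    2 ^ (n - d) ≤ (Finset.univ.filter fun u => g u ≠ 0).card := by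
  classical
  obtain ⟨S, hS, hmax⟩ := exists_maximal_moeb_ne_zero g hne
  have hSd : S.card ≤ d := not_lt.1 fun h => hS (moeb_eq_zero_of_mem_lowDeg hg h)
  set P : Finset (Fin n → Bool) := Finset.univ.filter fun v => ∀ i ∈ S, v i = false with hPdef
  have hrest : ∀ v : Fin n → Bool, ∃ u : Fin n → Bool, g (merge S u v) ≠ 0 := by
    intro v
    by_contra h
    push Not at h
    apply hS
    rw [← moeb_restr_eq g S hmax v]
    have h0 : restr S v g = 0 := funext fun u => h u
    rw [h0]
    simp [moeb]
  choose φ hφ using hrest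
  have hinj : Set.InjOn (fun v => merge S (φ v) v) ↑P := by
    intro v hv v' hv' heq
    funext i
    have hvi := (Finset.mem_filter.1 (Finset.mem_coe.1 hv)).2
    have hv'i := (Finset.mem_filter.1 (Finset.mem_coe.1 hv')).2
    by_cases hi : i ∈ S
    · rw [hvi i hi, hv'i i hi]
    · have h' := congrFun heq i
      simpa [merge, hi] using h'
  have hmaps : Set.MapsTo (fun v => merge S (φ v) v) ↑P ↑(Finset.univ.filter fun u => g u ≠ 0) :=
    fun v _ => Finset.mem_coe.2 (Finset.mem_filter.2 ⟨Finset.mem_univ _, hφ v⟩)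
  have hcardP : P.card = 2 ^ (n - S.card) := by
    have hP : P = Fintype.piFinset fun i => if i ∈ S then ({false} : Finset Bool) else Finset.univ := by
      ext v
      rw [hPdef, Finset.mem_filter, Fintype.mem_piFinset]
      constructor
      · intro h i
        by_cases hi : i ∈ S
        · rw [if_pos hi, Finset.mem_singleton]; exact h.2 i hi
        · rw [if_neg hi]; exact Finset.mem_univ _
      · intro h
        refine ⟨Finset.mem_univ _, fun i hi => ?_⟩
        have h' := h i
        rw [if_pos hi, Finset.mem_singleton] at h'
        exact h'
    rw [hP, Fintype.card_piFinset]
    have h2 : ∀ i : Fin n, (if i ∈ S then ({false} : Finset Bool) else Finset.univ).card = if i ∈ S then 1 else 2 := by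
      intro i
      split_ifs <;> simp
    simp_rw [h2]
    rw [Finset.prod_ite, Finset.prod_const_one, one_mul, Finset.prod_const]
    congr 1
    have hc : (Finset.univ.filter fun i : Fin n => ¬ i ∈ S) = Finset.univ \ S := by
      ext i
      simp
    rw [hc, Finset.card_univ_sdiff, Fintype.card_fin]
  calc 2 ^ (n - d) ≤ 2 ^ (n - S.card) := Nat.pow_le_pow_right (by norm_num) (by omega)
    _ = P.card := hcardP.symm
    _ ≤ (Finset.univ.filter fun u => g u ≠ 0).card := Finset.card_le_card_of_injOn _ hmaps hinj

/-- Boolean form: a Boolean `f` with `HasDegF p f d` that is not identically `false` is `true` on ≥ `2^{n−d}` points. -/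
theorem card_true_ge_of_hasDegF (p : ℕ) [Fact p.Prime] {d : ℕ} {f : (Fin n → Bool) → Bool}
    (hf : HasDegF p f d) (hne : ∃ u, f u = true) :
    2 ^ (n - d) ≤ (Finset.univ.filter fun u => f u = true).card := by
  classical
  have hne' : indR (ZMod p) f ≠ 0 := by
    obtain ⟨u, hu⟩ := hne
    intro h
    have h' := congrFun h u
    simp [indR, hu] at h'
  have h := card_support_ge_of_mem_lowDeg ((hasDegF_iff_indR p f d).1 hf) hne'
  have heq : (Finset.univ.filter fun u => indR (ZMod p) f u ≠ 0) = (Finset.univ.filter fun u => f u = true) := by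
    ext u
    simp only [Finset.mem_filter, Finset.mem_univ, true_and, indR]
    by_cases hu : f u = true
    · simp [hu]
    · simp [hu]
  rwa [heq] at h

end Field

end SubLog

end Summit.QuantumAdvantage.AdviceFreeQNC0
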